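import Mathlib
import Literature.Analysis.FluidPDE.PressureRepresentation
import Literature.Analysis.FluidPDE.TaoEnstrophyLocalisationProofs

/-!
# Route PlaneEnergyCeiling · crux `PlanarEnergyAPriori` · line `birth` — decay tools for the pressure potential

Helper file toward the registered stub `stub_decayPersistence` (order-(3,2) spatial decay persists along a
classical Leray–Hopf solution) of the crux item stmt-NavierStokesRegularity-16855 (`PlanarEnergyAPriori`),
landed `--supports` that item. First half of the proof that Tao's pressure potential
`Q[v] = -Γ₀ * G[v] - (D²Γ∞) * (v ⊗ v)` (`pressurePotential`, `FluidPDE/PressureRepresentation`;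
`G[v] = ∂ᵢ∂ⱼ(vᵢvⱼ)`, `Γ = Γ₀ + Γ∞` the near/far splitting of the Newtonian kernel) of a smooth
divergence-free field `v : ℝ³ → ℝ³` with CUBIC decay `(1 + |y|)³ ‖Dᵏv(y)‖ ≤ C` (`k ≤ 3`) decays
quadratically together with its gradient (assembled in `…PressureDecay.lean`):

* the source and its gradient decay like `(1 + |y|)⁻⁶`: `(1 + |y|)⁶ (|G[v]| , ‖DG[v]‖) ≤ (2τC², 4τC²)`,
  `τ = ‖tr‖` (Leibniz bound `norm_iteratedFDeriv_clm_apply` for `(v·∇)v = Dv(v)`, `G = tr ∘ D((v·∇)v)`);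
* `∫|v|² ≤ C² ∫(1 + |y|)⁻⁶`;
* the near kernel AT THE SCALE OF THE POINT, `R = (1 + |x|)/4`: `‖∫ Γ₀^{R,2R}(z) • g(x - z) dz‖ ≤ 4BJ(1 + |x|)⁻⁴`
  for `(1 + |y|)⁶‖g(y)‖ ≤ B` (`J = ∫|Γ₀^{1,2}|`; mass `R²J`, and the kernel only sees `1 + |y| ≥ (1 + |x|)/2`);
* the far kernel: scaling `D³Γ∞^{cr₀,cr₁}(z) = c⁻⁴ D³Γ∞^{r₀,r₁}(c⁻¹z)` and the derivative of the far potential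
  `DQ₂[v](x₀) = ∫ evalDiag(v y) ∘ D³Γ∞(x₀ - y) dy`, of norm `≤ M₁ ∫|v|²`.

Folklore potential theory (Gilbarg–Trudinger 2001, Lemma 4.1–4.2).
-/

noncomputable section

-- single-conjunct summit: `Summit.<Summit>.<Problem>` repeats the name by the D-0017 layout
set_option linter.dupNamespace false
-- nested operator types `ℝ³ →L[ℝ] ℝ³ →L[ℝ] ℝ³ →L[ℝ] ℝ` (third derivatives of the far kernel)
set_option maxSynthPendingDepth 4

namespace Summit.NavierStokesRegularity.NavierStokesRegularity.Theorems.PlanarEnergyAPriori.PressureDecay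

open MeasureTheory Set Filter Metric Topology Function Real
open scoped ContDiff ENNReal
open Literature.Analysis.FluidPDE


/-! ### Decay of the quadratic source `G[v] = ∂ᵢ∂ⱼ(vᵢvⱼ)` and of its gradient -/

section Source

variable {v : (EuclideanSpace ℝ (Fin 3)) → (EuclideanSpace ℝ (Fin 3))} {C : ℝ}

/-- The decay constant is nonnegative. -/
theorem const_nonneg (hC : ∀ (y : (EuclideanSpace ℝ (Fin 3))) (k : ℕ), k ≤ 3 → (1 + ‖y‖) ^ 3 * ‖iteratedFDeriv ℝ k v y‖ ≤ C) :
    0 ≤ C :=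
  le_trans (by positivity) (hC 0 0 (by norm_num))

/-- Products of two derivatives of order `≤ 3` decay like `(1 + |y|)⁻⁶`. -/
theorem weight_six_mul_prod_le
    (hC : ∀ (y : (EuclideanSpace ℝ (Fin 3))) (k : ℕ), k ≤ 3 → (1 + ‖y‖) ^ 3 * ‖iteratedFDeriv ℝ k v y‖ ≤ C) (y : (EuclideanSpace ℝ (Fin 3))) {i j : ℕ}
    (hi : i ≤ 3) (hj : j ≤ 3) :
    (1 + ‖y‖) ^ 6 * (‖iteratedFDeriv ℝ i v y‖ * ‖iteratedFDeriv ℝ j v y‖) ≤ C * C := by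
  have h1 := hC y i hi
  have h2 := hC y j hj
  calc (1 + ‖y‖) ^ 6 * (‖iteratedFDeriv ℝ i v y‖ * ‖iteratedFDeriv ℝ j v y‖)
      = ((1 + ‖y‖) ^ 3 * ‖iteratedFDeriv ℝ i v y‖) * ((1 + ‖y‖) ^ 3 * ‖iteratedFDeriv ℝ j v y‖) := by ring
    _ ≤ C * C := mul_le_mul h1 h2 (by positivity) (const_nonneg hC)

/-- **Decay of `D((v·∇)v)` and `D²((v·∇)v)`**: `(1 + |y|)⁶ ‖Dⁿ((v·∇)v)(y)‖ ≤ 2ⁿ C²` for `n = 1, 2`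
(Leibniz bound `norm_iteratedFDeriv_clm_apply` for `y ↦ Dv(y)(v(y))`). -/
theorem weight_six_mul_norm_iteratedFDeriv_convect_le (hv : ContDiff ℝ ∞ v)
    (hC : ∀ (y : (EuclideanSpace ℝ (Fin 3))) (k : ℕ), k ≤ 3 → (1 + ‖y‖) ^ 3 * ‖iteratedFDeriv ℝ k v y‖ ≤ C) (y : (EuclideanSpace ℝ (Fin 3))) :
    (1 + ‖y‖) ^ 6 * ‖iteratedFDeriv ℝ 1 (convect v v) y‖ ≤ 2 * C ^ 2 ∧
      (1 + ‖y‖) ^ 6 * ‖iteratedFDeriv ℝ 2 (convect v v) y‖ ≤ 4 * C ^ 2 := by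
  have hf : ContDiff ℝ ∞ (fderiv ℝ v) := hv.fderiv_right (m := ∞) (by exact_mod_cast le_top)
  have hconv : convect v v = fun y => (fderiv ℝ v y) (v y) := rfl
  have hw : 0 ≤ (1 + ‖y‖) ^ 6 := by positivity
  have key := fun (i j : ℕ) (hi : i ≤ 3) (hj : j ≤ 3) => weight_six_mul_prod_le hC y hi hj
  have h2top : ((2 : ℕ) : WithTop ℕ∞) ≤ ((⊤ : ℕ∞) : WithTop ℕ∞) := WithTop.coe_le_coe.2 le_top
  have h1top : ((1 : ℕ) : WithTop ℕ∞) ≤ ((⊤ : ℕ∞) : WithTop ℕ∞) := WithTop.coe_le_coe.2 le_top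
  constructor
  · have h := norm_iteratedFDeriv_clm_apply (n := 1) hf hv y h1top
    rw [Finset.sum_range_succ, Finset.sum_range_succ, Finset.sum_range_zero] at h
    simp only [Nat.choose_zero_right, Nat.cast_one, one_mul, Nat.sub_zero, Nat.choose_self,
      zero_add, norm_iteratedFDeriv_fderiv, Nat.reduceAdd, Nat.reduceSub] at h
    rw [hconv]
    calc (1 + ‖y‖) ^ 6 * ‖iteratedFDeriv ℝ 1 (fun y => (fderiv ℝ v y) (v y)) y‖
        ≤ (1 + ‖y‖) ^ 6 * (‖iteratedFDeriv ℝ 1 v y‖ * ‖iteratedFDeriv ℝ 1 v y‖ +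
            ‖iteratedFDeriv ℝ 2 v y‖ * ‖iteratedFDeriv ℝ 0 v y‖) :=
          mul_le_mul_of_nonneg_left h hw
      _ = (1 + ‖y‖) ^ 6 * (‖iteratedFDeriv ℝ 1 v y‖ * ‖iteratedFDeriv ℝ 1 v y‖) +
            (1 + ‖y‖) ^ 6 * (‖iteratedFDeriv ℝ 2 v y‖ * ‖iteratedFDeriv ℝ 0 v y‖) := by ring
      _ ≤ C * C + C * C := add_le_add (key 1 1 (by norm_num) (by norm_num))
          (key 2 0 (by norm_num) (by norm_num))
      _ = 2 * C ^ 2 := by ring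
  · have h := norm_iteratedFDeriv_clm_apply (n := 2) hf hv y h2top
    rw [Finset.sum_range_succ, Finset.sum_range_succ, Finset.sum_range_succ, Finset.sum_range_zero] at h
    simp only [Nat.choose_zero_right, Nat.cast_one, one_mul, Nat.sub_zero, Nat.choose_self,
      zero_add, norm_iteratedFDeriv_fderiv, Nat.choose_one_right, Nat.cast_ofNat,
      Nat.reduceAdd, Nat.reduceSub] at h
    rw [hconv]
    calc (1 + ‖y‖) ^ 6 * ‖iteratedFDeriv ℝ 2 (fun y => (fderiv ℝ v y) (v y)) y‖
        ≤ (1 + ‖y‖) ^ 6 * (‖iteratedFDeriv ℝ 1 v y‖ * ‖iteratedFDeriv ℝ 2 v y‖ +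
            2 * ‖iteratedFDeriv ℝ 2 v y‖ * ‖iteratedFDeriv ℝ 1 v y‖ +
            ‖iteratedFDeriv ℝ 3 v y‖ * ‖iteratedFDeriv ℝ 0 v y‖) :=
          mul_le_mul_of_nonneg_left h hw
      _ = (1 + ‖y‖) ^ 6 * (‖iteratedFDeriv ℝ 1 v y‖ * ‖iteratedFDeriv ℝ 2 v y‖) +
            2 * ((1 + ‖y‖) ^ 6 * (‖iteratedFDeriv ℝ 2 v y‖ * ‖iteratedFDeriv ℝ 1 v y‖)) +
            (1 + ‖y‖) ^ 6 * (‖iteratedFDeriv ℝ 3 v y‖ * ‖iteratedFDeriv ℝ 0 v y‖) := by ring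
      _ ≤ C * C + 2 * (C * C) + C * C :=
          add_le_add (add_le_add (key 1 2 (by norm_num) (by norm_num))
            (mul_le_mul_of_nonneg_left (key 2 1 (by norm_num) (by norm_num)) zero_le_two))
            (key 3 0 (by norm_num) (by norm_num))
      _ = 4 * C ^ 2 := by ring

/-- **Decay of the source and of its gradient**: for divergence-free `v`,
`(1 + |y|)⁶ |G[v](y)| ≤ 2τC²` and `(1 + |y|)⁶ ‖DG[v](y)‖ ≤ 4τC²`, `τ = ‖tr‖` the norm of the trace on
`ℝ³ →L ℝ³` (`G[v] = div((v·∇)v) = tr ∘ D((v·∇)v)`). -/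
theorem weight_six_mul_pressureSource_le (hv : ContDiff ℝ ∞ v) (hdiv : VectorCalculus.IsDivFree v)
    (hC : ∀ (y : (EuclideanSpace ℝ (Fin 3))) (k : ℕ), k ≤ 3 → (1 + ‖y‖) ^ 3 * ‖iteratedFDeriv ℝ k v y‖ ≤ C) (y : (EuclideanSpace ℝ (Fin 3))) :
    (1 + ‖y‖) ^ 6 * |pressureSource v y| ≤ 2 * ‖(traceCLM : ((EuclideanSpace ℝ (Fin 3)) →L[ℝ] (EuclideanSpace ℝ (Fin 3))) →L[ℝ] ℝ)‖ * C ^ 2 ∧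
      (1 + ‖y‖) ^ 6 * ‖fderiv ℝ (pressureSource v) y‖ ≤
        4 * ‖(traceCLM : ((EuclideanSpace ℝ (Fin 3)) →L[ℝ] (EuclideanSpace ℝ (Fin 3))) →L[ℝ] ℝ)‖ * C ^ 2 := by
  set h : (EuclideanSpace ℝ (Fin 3)) → (EuclideanSpace ℝ (Fin 3)) := convect v v with hh
  have hG : pressureSource v = (traceCLM : ((EuclideanSpace ℝ (Fin 3)) →L[ℝ] (EuclideanSpace ℝ (Fin 3))) →L[ℝ] ℝ) ∘ fderiv ℝ h := by
    rw [pressureSource_eq_of_isDivFree hdiv, divergence_eq_traceCLM_comp]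
  have hf : ContDiff ℝ ∞ (fderiv ℝ v) := hv.fderiv_right (m := ∞) (by exact_mod_cast le_top)
  have hhs : ContDiff ℝ ∞ h := hf.clm_apply hv
  have hDh : ContDiff ℝ ∞ (fderiv ℝ h) := hhs.fderiv_right (m := ∞) (by exact_mod_cast le_top)
  have hw : 0 ≤ (1 + ‖y‖) ^ 6 := by positivity
  obtain ⟨τ, hτ⟩ : ∃ τ : ℝ, τ = ‖(traceCLM : ((EuclideanSpace ℝ (Fin 3)) →L[ℝ] (EuclideanSpace ℝ (Fin 3))) →L[ℝ] ℝ)‖ := ⟨_, rfl⟩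
  rw [← hτ]
  have hτ0 : 0 ≤ τ := by
    rw [hτ]; exact norm_nonneg (traceCLM : ((EuclideanSpace ℝ (Fin 3)) →L[ℝ] (EuclideanSpace ℝ (Fin 3))) →L[ℝ] ℝ)
  -- `‖Dᵐ G‖ ≤ τ ‖Dᵐ⁺¹ h‖`
  have hcomp : ∀ m : ℕ, ‖iteratedFDeriv ℝ m (pressureSource v) y‖ ≤ τ * ‖iteratedFDeriv ℝ (m + 1) h y‖ := by
    intro m
    rw [hG, ContinuousLinearMap.iteratedFDeriv_comp_left _ (hDh.contDiffAt) (i := m)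
      (by exact_mod_cast le_top), ← norm_iteratedFDeriv_fderiv, hτ]
    exact ContinuousLinearMap.norm_compContinuousMultilinearMap_le _ _
  obtain ⟨h1, h2⟩ := weight_six_mul_norm_iteratedFDeriv_convect_le hv hC y
  constructor
  · have e : |pressureSource v y| = ‖iteratedFDeriv ℝ 0 (pressureSource v) y‖ := by
      rw [norm_iteratedFDeriv_zero, Real.norm_eq_abs]
    rw [e]
    calc (1 + ‖y‖) ^ 6 * ‖iteratedFDeriv ℝ 0 (pressureSource v) y‖
        ≤ (1 + ‖y‖) ^ 6 * (τ * ‖iteratedFDeriv ℝ (0 + 1) h y‖) := mul_le_mul_of_nonneg_left (hcomp 0) hw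
      _ = τ * ((1 + ‖y‖) ^ 6 * ‖iteratedFDeriv ℝ 1 h y‖) := by ring
      _ ≤ τ * (2 * C ^ 2) := mul_le_mul_of_nonneg_left h1 hτ0
      _ = 2 * τ * C ^ 2 := by ring
  · have e : ‖fderiv ℝ (pressureSource v) y‖ = ‖iteratedFDeriv ℝ 1 (pressureSource v) y‖ := by
      rw [← norm_iteratedFDeriv_fderiv, norm_iteratedFDeriv_zero]
    rw [e]
    calc (1 + ‖y‖) ^ 6 * ‖iteratedFDeriv ℝ 1 (pressureSource v) y‖
        ≤ (1 + ‖y‖) ^ 6 * (τ * ‖iteratedFDeriv ℝ (1 + 1) h y‖) := mul_le_mul_of_nonneg_left (hcomp 1) hw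
      _ = τ * ((1 + ‖y‖) ^ 6 * ‖iteratedFDeriv ℝ 2 h y‖) := by ring
      _ ≤ τ * (4 * C ^ 2) := mul_le_mul_of_nonneg_left h2 hτ0
      _ = 4 * τ * C ^ 2 := by ring

/-- `|v|² ≤ C²(1 + |y|)⁻⁶`, in real-power form. -/
theorem norm_sq_le_rpow (hC : ∀ (y : (EuclideanSpace ℝ (Fin 3))) (k : ℕ), k ≤ 3 → (1 + ‖y‖) ^ 3 * ‖iteratedFDeriv ℝ k v y‖ ≤ C)
    (y : (EuclideanSpace ℝ (Fin 3))) : ‖v y‖ ^ 2 ≤ C ^ 2 * (1 + ‖y‖) ^ (-(6 : ℝ)) := by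
  have h0 := hC y 0 (by norm_num)
  rw [norm_iteratedFDeriv_zero] at h0
  have hw : 0 < 1 + ‖y‖ := by positivity
  have h1 : ‖v y‖ ≤ C / (1 + ‖y‖) ^ 3 := by
    rw [le_div_iff₀ (by positivity), mul_comm]; exact h0
  have h2 : ‖v y‖ ^ 2 ≤ (C / (1 + ‖y‖) ^ 3) ^ 2 := pow_le_pow_left₀ (norm_nonneg _) h1 2
  calc ‖v y‖ ^ 2 ≤ (C / (1 + ‖y‖) ^ 3) ^ 2 := h2
    _ = C ^ 2 * (1 + ‖y‖) ^ (-(6 : ℝ)) := by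
        rw [Real.rpow_neg hw.le, show (6 : ℝ) = ((6 : ℕ) : ℝ) by norm_num, Real.rpow_natCast]
        field_simp

/-- `|v|² ∈ L¹(ℝ³)` with `∫ |v|² ≤ C² ∫ (1 + |y|)⁻⁶`. -/
theorem integrable_norm_sq (hv : Continuous v)
    (hC : ∀ (y : (EuclideanSpace ℝ (Fin 3))) (k : ℕ), k ≤ 3 → (1 + ‖y‖) ^ 3 * ‖iteratedFDeriv ℝ k v y‖ ≤ C) :
    Integrable (fun y => ‖v y‖ ^ 2) ∧
      ∫ y, ‖v y‖ ^ 2 ≤ C ^ 2 * ∫ y : (EuclideanSpace ℝ (Fin 3)), (1 + ‖y‖) ^ (-(6 : ℝ)) := by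
  have hI : Integrable fun y : (EuclideanSpace ℝ (Fin 3)) => (1 + ‖y‖) ^ (-(6 : ℝ)) :=
    integrable_one_add_norm (by rw [finrank_euclideanSpace_fin]; norm_num)
  have hint : Integrable (fun y => ‖v y‖ ^ 2) := by
    refine Integrable.mono' (hI.const_mul (C ^ 2)) (hv.norm.pow 2).aestronglyMeasurable
      (Eventually.of_forall fun y => ?_)
    rw [Real.norm_eq_abs, abs_of_nonneg (by positivity)]
    exact norm_sq_le_rpow hC y
  refine ⟨hint, ?_⟩
  rw [← integral_const_mul]
  exact integral_mono hint (hI.const_mul _) fun y => norm_sq_le_rpow hC y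

end Source

/-! ### An `L¹` kernel at the scale `R = (1 + |x|)/4` against a decaying function -/

section Near

variable {F : Type*} [NormedAddCommGroup F] [NormedSpace ℝ F]

/-- An `L¹` kernel vanishing off the ball of radius `ρ` against a function bounded by `S` on the
translates `x - z`, `|z| ≤ ρ`: `‖∫ k(z) • g(x - z) dz‖ ≤ S ∫|k|`. -/
theorem norm_integral_smul_comp_sub_le {k : (EuclideanSpace ℝ (Fin 3)) → ℝ} {ρ : ℝ} (hk : Integrable k)
    (hkρ : ∀ z, ρ < ‖z‖ → k z = 0) {g : (EuclideanSpace ℝ (Fin 3)) → F} {S : ℝ} (x : (EuclideanSpace ℝ (Fin 3)))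
    (hg : ∀ z, ‖z‖ ≤ ρ → ‖g (x - z)‖ ≤ S) :
    ‖∫ z, k z • g (x - z)‖ ≤ S * ∫ z, |k z| := by
  have h1 : ‖∫ z, k z • g (x - z)‖ ≤ ∫ z, |k z| * S := by
    refine norm_integral_le_of_norm_le (hk.norm.mul_const S) (Eventually.of_forall fun z => ?_)
    by_cases hz : ‖z‖ ≤ ρ
    · rw [norm_smul, Real.norm_eq_abs]
      exact mul_le_mul_of_nonneg_left (hg z hz) (abs_nonneg _)
    · rw [hkρ z (not_le.1 hz), zero_smul, norm_zero]
      simp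
  rw [integral_mul_const] at h1
  linarith

/-- **The near kernel at the scale of the point.** For `g` with `(1 + |y|)⁶ ‖g(y)‖ ≤ B` and
`R = (1 + |x|)/4`: `‖∫ Γ₀^{R,2R}(z) • g(x - z) dz‖ ≤ 4 B J (1 + |x|)⁻⁴`, `J = ∫|Γ₀^{1,2}|`
(the kernel has mass `R² J` and sees only points `y = x - z` with `1 + |y| ≥ (1 + |x|)/2`). -/
theorem norm_integral_newtonNear_scale_smul_le {g : (EuclideanSpace ℝ (Fin 3)) → F} {B : ℝ} (hB : 0 ≤ B)
    (hg : ∀ y, (1 + ‖y‖) ^ 6 * ‖g y‖ ≤ B) (x : (EuclideanSpace ℝ (Fin 3))) {R : ℝ} (hRx : R = (1 + ‖x‖) / 4) :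
    ‖∫ z, newtonNear (R * 1) (R * 2) z • g (x - z)‖ ≤
      4 * B * (∫ w, |newtonNear 1 2 w|) / (1 + ‖x‖) ^ 4 := by
  subst hRx
  have hx : 0 < 1 + ‖x‖ := by positivity
  have hR : 0 < (1 + ‖x‖) / 4 := by positivity
  have h0 : (0 : ℝ) ≤ (1 + ‖x‖) / 4 * 1 := by positivity
  have h12 : (1 + ‖x‖) / 4 * 1 < (1 + ‖x‖) / 4 * 2 := by linarith
  -- the bound on the translates
  have hS : ∀ z : (EuclideanSpace ℝ (Fin 3)), ‖z‖ ≤ (1 + ‖x‖) / 4 * 2 → ‖g (x - z)‖ ≤ 64 * B / (1 + ‖x‖) ^ 6 := by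
    intro z hz
    have hy : (1 + ‖x‖) / 2 ≤ 1 + ‖x - z‖ := by
      have := norm_sub_norm_le x z
      linarith
    have hy0 : 0 < 1 + ‖x - z‖ := by positivity
    have h1 : ‖g (x - z)‖ ≤ B / (1 + ‖x - z‖) ^ 6 := by
      rw [le_div_iff₀ (by positivity), mul_comm]; exact hg (x - z)
    have h2 : ((1 + ‖x‖) / 2) ^ 6 ≤ (1 + ‖x - z‖) ^ 6 := pow_le_pow_left₀ (by positivity) hy 6
    calc ‖g (x - z)‖ ≤ B / (1 + ‖x - z‖) ^ 6 := h1
      _ ≤ B / ((1 + ‖x‖) / 2) ^ 6 := div_le_div_of_nonneg_left hB (by positivity) h2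
      _ = 64 * B / (1 + ‖x‖) ^ 6 := by field_simp; ring
  have h := norm_integral_smul_comp_sub_le (integrable_newtonNear h0 h12)
    (fun z hz => newtonNear_eq_zero h0 h12 hz.le) x hS
  rw [integral_abs_newtonNear_scale hR] at h
  calc ‖∫ z, newtonNear ((1 + ‖x‖) / 4 * 1) ((1 + ‖x‖) / 4 * 2) z • g (x - z)‖
      ≤ 64 * B / (1 + ‖x‖) ^ 6 * (((1 + ‖x‖) / 4) ^ 2 * ∫ w, |newtonNear 1 2 w|) := h
    _ = 4 * B * (∫ w, |newtonNear 1 2 w|) / (1 + ‖x‖) ^ 4 := by field_simp; ring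

end Near

/-! ### The far kernel at the scale `R`: third derivatives and the derivative of `Q₂` -/

section Far

variable {r₀ r₁ : ℝ}

/-- **Scaling of `D³Γ∞`**: `D³Γ∞^{cr₀,cr₁}(z) = c⁻⁴ D³Γ∞^{r₀,r₁}(c⁻¹z)`. -/
theorem fderiv3_newtonFar_scale {c : ℝ} (hc : 0 < c) (r₀ r₁ : ℝ) (z : (EuclideanSpace ℝ (Fin 3))) :
    fderiv ℝ (fderiv ℝ (fderiv ℝ (newtonFar (c * r₀) (c * r₁)))) z =
      c⁻¹ ^ 4 • fderiv ℝ (fderiv ℝ (fderiv ℝ (newtonFar r₀ r₁))) (c⁻¹ • z) := by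
  have h : fderiv ℝ (fderiv ℝ (newtonFar (c * r₀) (c * r₁))) =
      fun z => c⁻¹ ^ 3 • fderiv ℝ (fderiv ℝ (newtonFar r₀ r₁)) (c⁻¹ • z) :=
    funext (fderiv2_newtonFar_scale hc r₀ r₁)
  rw [h, fderiv_const_smul_comp_smul _ _ (inv_ne_zero hc.ne')]
  simp only
  rw [show c⁻¹ ^ 3 * c⁻¹ = c⁻¹ ^ 4 by ring]

/-- A uniform bound `‖D³Γ∞^{r₀,r₁}‖ ≤ M` rescales to `‖D³Γ∞^{cr₀,cr₁}‖ ≤ c⁻⁴ M`. -/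
theorem norm_fderiv3_newtonFar_scale_le {c : ℝ} (hc : 0 < c) {M : ℝ}
    (hM : ∀ w, ‖fderiv ℝ (fderiv ℝ (fderiv ℝ (newtonFar r₀ r₁))) w‖ ≤ M) (z : (EuclideanSpace ℝ (Fin 3))) :
    ‖fderiv ℝ (fderiv ℝ (fderiv ℝ (newtonFar (c * r₀) (c * r₁)))) z‖ ≤ c⁻¹ ^ 4 * M := by
  rw [fderiv3_newtonFar_scale hc, norm_smul, norm_pow, norm_inv, Real.norm_eq_abs, abs_of_pos hc]
  exact mul_le_mul_of_nonneg_left (hM _) (by positivity)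

/-- **The derivative of the far potential** `Q₂[v](x) = ∫ D²Γ∞(x - y)(v y, v y) dy` (bounded kernels
`D²Γ∞`, `D³Γ∞` against the integrable weights `evalDiag (v y)`):
`DQ₂[v](x₀) = ∫ evalDiag(v y) ∘ D³Γ∞(x₀ - y) dy`, of norm `≤ M₁ ∫|v|²` if `‖D³Γ∞‖ ≤ M₁`. -/
theorem hasFDerivAt_farPotential (h₀ : 0 < r₀) (h₁ : r₀ < r₁) {v : (EuclideanSpace ℝ (Fin 3)) → (EuclideanSpace ℝ (Fin 3))} (hv : Continuous v)
    (hL2 : Integrable fun y => ‖v y‖ ^ 2) {M₁ : ℝ}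
    (hM₁ : ∀ w, ‖fderiv ℝ (fderiv ℝ (fderiv ℝ (newtonFar r₀ r₁))) w‖ ≤ M₁) (x₀ : (EuclideanSpace ℝ (Fin 3))) :
    HasFDerivAt (farPotential r₀ r₁ v)
      (∫ y, (evalDiag (v y)).comp (fderiv ℝ (fderiv ℝ (fderiv ℝ (newtonFar r₀ r₁))) (x₀ - y))) x₀ ∧
    ‖∫ y, (evalDiag (v y)).comp (fderiv ℝ (fderiv ℝ (fderiv ℝ (newtonFar r₀ r₁))) (x₀ - y))‖ ≤
      M₁ * ∫ y, ‖v y‖ ^ 2 := by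
  obtain ⟨M₀, -, -, hM₀, -, -⟩ := exists_bounds_fderiv2_newtonFar h₀ h₁
  have hΦ : ContDiff ℝ 1 (fderiv ℝ (fderiv ℝ (newtonFar r₀ r₁))) :=
    (contDiff_fderiv2_newtonFar h₀ h₁).of_le one_le_two
  have hLc : Continuous fun y => evalDiag (v y) := continuous_evalDiag.comp hv
  have hLi : Integrable fun y => evalDiag (v y) := integrable_evalDiag_comp hv hL2
  have hM₁0 : 0 ≤ M₁ := (norm_nonneg _).trans (hM₁ 0)
  refine ⟨?_, ?_⟩
  · have h := hasFDerivAt_integral_clm_apply_comp_sub (L := fun y => evalDiag (v y)) hΦ hM₀ hM₁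
      hLc hLi x₀
    rw [farPotential_eq]
    exact h
  · have h1 : ‖∫ y, (evalDiag (v y)).comp (fderiv ℝ (fderiv ℝ (fderiv ℝ (newtonFar r₀ r₁))) (x₀ - y))‖
        ≤ ∫ y, ‖evalDiag (v y)‖ * M₁ := by
      refine norm_integral_le_of_norm_le (hLi.norm.mul_const M₁) (Eventually.of_forall fun y => ?_)
      exact (ContinuousLinearMap.opNorm_comp_le _ _).trans
        (mul_le_mul_of_nonneg_left (hM₁ _) (norm_nonneg _))
    rw [integral_mul_const] at h1
    calc _ ≤ (∫ y, ‖evalDiag (v y)‖) * M₁ := h1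
      _ ≤ (∫ y, ‖v y‖ ^ 2) * M₁ :=
          mul_le_mul_of_nonneg_right (integral_norm_evalDiag_comp_le hv hL2) hM₁0
      _ = M₁ * ∫ y, ‖v y‖ ^ 2 := mul_comm _ _


/-- **Registered helper sub-goal `pressureDecay_farKernel_scale`** (item stmt-NavierStokesRegularity-16855, toward
`stub_decayPersistence`): the scaling law of the third derivative of the far Newtonian kernel,
`D³Γ∞^{cr₀,cr₁}(z) = c⁻⁴ D³Γ∞^{r₀,r₁}(c⁻¹z)` (`fderiv3_newtonFar_scale`, registered shape). -/
theorem pressureDecay_farKernel_scale : ∀ (c : ℝ), 0 < c → ∀ (r₀ r₁ : ℝ) (z : EuclideanSpace ℝ (Fin 3)), fderiv ℝ (fderiv ℝ (fderiv ℝ (Literature.Analysis.FluidPDE.newtonFar (c * r₀) (c * r₁)))) z = c⁻¹ ^ 4 • fderiv ℝ (fderiv ℝ (fderiv ℝ (Literature.Analysis.FluidPDE.newtonFar r₀ r₁))) (c⁻¹ • z) :=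
  fun _ hc r₀ r₁ z => fderiv3_newtonFar_scale hc r₀ r₁ z

end Far

end Summit.NavierStokesRegularity.NavierStokesRegularity.Theorems.PlanarEnergyAPriori.PressureDecay

end
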